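import Summits.Langlands.Langlands.Theses.TwistAveragedDeinduction

/-!
# Birth skeleton — piece `LocalGlobalUpgrade` of the decomposition of `AJunction`
(route TwistAveragedDeinduction, parent crux stmt-Langlands-16013; strategist planner-cstrat-stmt-Langlands-16013-r1-0)

Two registered stubs, the standard ℓ ≠ p / ℓ = p division of local–global compatibility
(Caraiani 2012 / 2014; Varma 2024 / A'Campo 2023–Hevesi 2023), and the kernel-checked composition
`LocalGlobalUpgrade_of`.  `stub_awayFromL` supplies the ONE datum `Rec` per field (ℓ ≠ p
compatibility for every a.e.-matched irreducible pair pins `rec_v` on all local components that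
occur); `stub_atL` says such a datum is automatically de Rham and `D_pst`-compatible above ℓ.
Sorries ONLY inside `stub_*`.
-/

namespace Summit.Langlands.Langlands.Cruxes.AJunction.BirthLocalGlobalUpgrade

open scoped BigOperators Topology Manifold Classical MeasureTheory ProbabilityTheory Matrix InnerProductSpace ComplexConjugate ContinuousMap
open Filter Set Function TopologicalSpace MeasureTheory
open Summit.Langlands.Langlands.Theses.TwistAveragedDeinduction

/-- The piece, verbatim (child `LocalGlobalUpgrade` of `AJunction`; not yet a route decl). -/
def LocalGlobalUpgrade : Prop :=
  ∀ (F : Type) [Field F] [NumberField F], ∃ Rec : Summit.Langlands.ReciprocityData F, ∀ (n : ℕ), 0 < n → ∀ (hF : Literature.NumberTheory.Automorphic.isCompact_glFiniteIntegralLevel n F) (ℓ : ℕ) [Fact ℓ.Prime] (ι : PadicAlgCl ℓ ≃+* ℂ) (π : Literature.NumberTheory.Automorphic.CuspidalAutomorphicRepData n F hF), π.1.IsLAlgebraic → ∀ ρ : Literature.NumberTheory.GaloisRepresentations.FramedGaloisRep F (PadicAlgCl ℓ) n, ρ.toGaloisRep.IsIrreducible → (∀ᶠ w : IsDedekindDomain.HeightOneSpectrum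 (NumberField.RingOfIntegers F) in cofinite, Summit.Langlands.SatakeFrobCompatibleAt ι π.1 ρ w) → Summit.Langlands.IsGeometricFramed Rec ρ ∧ Summit.Langlands.Corresponds Rec ι π.1 ρ

/-- **stub_awayFromL** (ℓ ≠ p local–global compatibility, all weights, all fields; XL/open off the
regular CM/polarised regimes): one reciprocity datum per number field such that every irreducible `ρ`
a.e.-matched with an L-algebraic cuspidal `π` satisfies `ι WD(ρ|Γ_(F_v))^(F-ss) ≅ rec_v(π_v)` at every
`v ∤ ℓ` (Grothendieck–Deligne recipe). [cite: VarmaFMS2024, Thm. 1] [cite: Caraiani2012, Thm. 1.1] -/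
theorem stub_awayFromL : ∀ (F : Type) [Field F] [NumberField F], ∃ Rec : Summit.Langlands.ReciprocityData F, ∀ (n : ℕ), 0 < n → ∀ (hF : Literature.NumberTheory.Automorphic.isCompact_glFiniteIntegralLevel n F) (ℓ : ℕ) [Fact ℓ.Prime] (ι : PadicAlgCl ℓ ≃+* ℂ) (π : Literature.NumberTheory.Automorphic.CuspidalAutomorphicRepData n F hF), π.1.IsLAlgebraic → ∀ ρ : Literature.NumberTheory.GaloisRepresentations.FramedGaloisRep F (PadicAlgCl ℓ) n, ρ.toGaloisRep.IsIrreducible → (∀ᶠ w : IsDedekindDomain.HeightOneSpectrum (NumberField.RingOfIntegers F) in cofinite, Summit.Langlands.SatakeFrobCompatibleAt ι π.1 ρ w) → ∀ v : IsDedekindDomain.HeightOneSpectrum (NumberField.RingOfIntegers F), ((ℓ : ℕ) : NumberField.RingOfIntegers F) ∉ v.asIdeal → Summit.Langlands.LocalGlobalCompatibleAt Rec ι π.1 ρ v := by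
  sorry

/-- **stub_atL** (ℓ = p: de Rham + `D_pst`-compatibility for a datum already compatible away from ℓ;
XL/open off the regular CM/polarised regimes). [cite: Caraiani2014, Thm. 1.1] [cite: Acampo2023, Thm. 1.1] [cite: BarnetlambEtAl2014, Thm. A] -/
theorem stub_atL : ∀ (F : Type) [Field F] [NumberField F] (Rec : Summit.Langlands.ReciprocityData F), (∀ (n : ℕ), 0 < n → ∀ (hF : Literature.NumberTheory.Automorphic.isCompact_glFiniteIntegralLevel n F) (ℓ : ℕ) [Fact ℓ.Prime] (ι : PadicAlgCl ℓ ≃+* ℂ) (π : Literature.NumberTheory.Automorphic.CuspidalAutomorphicRepData n F hF), π.1.IsLAlgebraic → ∀ ρ : Literature.NumberTheory.GaloisRepresentations.FramedGaloisRep F (PadicAlgCl ℓ) n, ρ.toGaloisRep.IsIrreducible → (∀ᶠ w : IsDedekindDomain.HeightOneSpectrum (NumberField.RingOfIntegers F) in cofinite, Summit.Langlands.SatakeFrobCompatibleAt ι π.1 ρ w) → ∀ v : IsDedekindDomain.HeightOneSpectrum (NumberField.RingOfIntegers F), ((ℓ : ℕ) : NumberField.RingOfIntegers F) ∉ v.asIdeal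 → Summit.Langlands.LocalGlobalCompatibleAt Rec ι π.1 ρ v) → ∀ (n : ℕ), 0 < n → ∀ (hF : Literature.NumberTheory.Automorphic.isCompact_glFiniteIntegralLevel n F) (ℓ : ℕ) [Fact ℓ.Prime] (ι : PadicAlgCl ℓ ≃+* ℂ) (π : Literature.NumberTheory.Automorphic.CuspidalAutomorphicRepData n F hF), π.1.IsLAlgebraic → ∀ ρ : Literature.NumberTheory.GaloisRepresentations.FramedGaloisRep F (PadicAlgCl ℓ) n, ρ.toGaloisRep.IsIrreducible → (∀ᶠ w : IsDedekindDomain.HeightOneSpectrum (NumberField.RingOfIntegers F) in cofinite, Summit.Langlands.SatakeFrobCompatibleAt ι π.1 ρ w) → ∀ (v : IsDedekindDomain.HeightOneSpectrum (NumberField.RingOfIntegers F)) (hv : ((ℓ : ℕ) : NumberField.RingOfIntegers F) ∈ v.asIdeal), (Rec.pst ℓ v hv).IsDeRhamFramed (ρ.toLocal v) ∧ Summit.Langlands.LocalGlobalCompatibleAt Rec ι π.1 ρ v := by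
  sorry

/-- **Composition**: the two stubs give the piece (case split on `v ∣ ℓ`; unramified a.e. is read off
the Satake–Frobenius matching). [folklore] -/
theorem LocalGlobalUpgrade_of : (∀ (F : Type) [Field F] [NumberField F], ∃ Rec : Summit.Langlands.ReciprocityData F, ∀ (n : ℕ), 0 < n → ∀ (hF : Literature.NumberTheory.Automorphic.isCompact_glFiniteIntegralLevel n F) (ℓ : ℕ) [Fact ℓ.Prime] (ι : PadicAlgCl ℓ ≃+* ℂ) (π : Literature.NumberTheory.Automorphic.CuspidalAutomorphicRepData n F hF), π.1.IsLAlgebraic → ∀ ρ : Literature.NumberTheory.GaloisRepresentations.FramedGaloisRep F (PadicAlgCl ℓ) n, ρ.toGaloisRep.IsIrreducible → (∀ᶠ w : IsDedekindDomain.HeightOneSpectrum (NumberField.RingOfIntegers F) in cofinite, Summit.Langlands.SatakeFrobCompatibleAt ι π.1 ρ w) → ∀ v : IsDedekindDomain.HeightOneSpectrum (NumberField.RingOfIntegers F), ((ℓ : ℕ) : NumberField.RingOfIntegers F) ∉ v.asIdeal → Summit.Langlands.LocalGlobalCompatibleAt Rec ι π.1 ρ v) → (∀ (F : Type) [Field F]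 [NumberField F] (Rec : Summit.Langlands.ReciprocityData F), (∀ (n : ℕ), 0 < n → ∀ (hF : Literature.NumberTheory.Automorphic.isCompact_glFiniteIntegralLevel n F) (ℓ : ℕ) [Fact ℓ.Prime] (ι : PadicAlgCl ℓ ≃+* ℂ) (π : Literature.NumberTheory.Automorphic.CuspidalAutomorphicRepData n F hF), π.1.IsLAlgebraic → ∀ ρ : Literature.NumberTheory.GaloisRepresentations.FramedGaloisRep F (PadicAlgCl ℓ) n, ρ.toGaloisRep.IsIrreducible → (∀ᶠ w : IsDedekindDomain.HeightOneSpectrum (NumberField.RingOfIntegers F) in cofinite, Summit.Langlands.SatakeFrobCompatibleAt ι π.1 ρ w) → ∀ v : IsDedekindDomain.HeightOneSpectrum (NumberField.RingOfIntegers F), ((ℓ : ℕ) : NumberField.RingOfIntegers F) ∉ v.asIdeal → Summit.Langlands.LocalGlobalCompatibleAt Rec ι π.1 ρ v) → ∀ (n : ℕ), 0 < n → ∀ (hF : Literature.NumberTheory.Automorphic.isCompact_glFiniteIntegralLevel n F) (ℓ : ℕ) [Fact ℓ.Prime] (ι : PadicAlgCl ℓ ≃+* ℂ) (π : Literature.NumberTheory.Automorphic.CuspidalAutomorphicRepData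 n F hF), π.1.IsLAlgebraic → ∀ ρ : Literature.NumberTheory.GaloisRepresentations.FramedGaloisRep F (PadicAlgCl ℓ) n, ρ.toGaloisRep.IsIrreducible → (∀ᶠ w : IsDedekindDomain.HeightOneSpectrum (NumberField.RingOfIntegers F) in cofinite, Summit.Langlands.SatakeFrobCompatibleAt ι π.1 ρ w) → ∀ (v : IsDedekindDomain.HeightOneSpectrum (NumberField.RingOfIntegers F)) (hv : ((ℓ : ℕ) : NumberField.RingOfIntegers F) ∈ v.asIdeal), (Rec.pst ℓ v hv).IsDeRhamFramed (ρ.toLocal v) ∧ Summit.Langlands.LocalGlobalCompatibleAt Rec ι π.1 ρ v) → LocalGlobalUpgrade := by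
  intro h1 h2 F _ _
  obtain ⟨Rec, hRec⟩ := h1 F
  refine ⟨Rec, fun n hn hF ℓ _ ι π hπ ρ hirr hae => ⟨⟨?_, fun v hv => ?_⟩, hae, fun v => ?_⟩⟩
  · exact hae.mono fun w hw => by obtain ⟨α, -, hur, -⟩ := hw; exact hur
  · exact (h2 F Rec hRec n hn hF ℓ ι π hπ ρ hirr hae v hv).1
  · by_cases hv : ((ℓ : ℕ) : NumberField.RingOfIntegers F) ∈ v.asIdeal
    · exact (h2 F Rec hRec n hn hF ℓ ι π hπ ρ hirr hae v hv).2
    · exact hRec n hn hF ℓ ι π hπ ρ hirr hae v hv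

end Summit.Langlands.Langlands.Cruxes.AJunction.BirthLocalGlobalUpgrade
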